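/-
Copyright: lit-balaban Phase-2 proof seat p30 (gen 3).  Statement-level skeleton of a published paper; no proof claims beyond what
the kernel checks below.
-/
import Literature.MathematicalPhysics.QuantumFieldTheory.BalabanImbrieJaffe1984to88.BIJ85Eq531Proof

/-!
# `BalabanImbrieJaffe1984to88.BIJ85Eq531ProofPart2` — T. Bałaban, J. Imbrie, A. Jaffe, *Renormalization of the Higgs model: minimizers,
propagators and the stability of mean field theory*, Commun. Math. Phys. **97** (1985) 299–329 [BalabanImbrieJaffe1985]:
the `∂^*` of **(5.3.1)** / (4.2.2) made EXPLICIT — the local formula of the adjoint lattice curl and its agreement with the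
covariant divergence (1.2) of [Balaban1985RegularSpaces] at the trivial background

statement-level skeleton of published theorems with citation tags; proofs where landed; nothing here is a claim about the Yang–Mills mass gap

PDF held: `paper:balaban1985-cmp97-bij-higgs-minimizers` (journal page = PDF page + 298).  Page read as image:
`run/shared/lean/pub/lit-balaban/lit-balaban-r15/pages/1985-cmp97-bij-higgs-minimizers-p019-x2.png` (p. 317 [PDF 19]).

CITATION HEADER (lean-in-tree rule).  Part of the lit-balaban TYPED SKELETON (HOME `run/shared/lean/pub/lit-balaban/`), Phase-2
seat p30 (gen 3); row **C1.Eq5.3.1** of `HOME/SKELETON.md` (reader file `HOME/lit-balaban-r15/ROWS-C1.md`), Part 2 of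
`BIJ85Eq531Proof` (append-only companion; the ≤ 400-line rule).  THE PRINTED TEXT, p. 317: *"H_{k,Ax}B = Q^{s*}_kB −
G_{k,Ax}∂^*Q^{e*}_k∂B. (5.3.1)"*; the operator `∂^*` is the adjoint of the lattice curl `∂` for the pairings (2.14)/(2.20) (equal
weights on the bonds and plaquettes of one lattice), DEFINED in Part 1 as the transpose `BIJ85Eq531Proof.plaqDiv c` of
`LatticeFieldCalculus.curl c` and PROVED adjoint there (`sum_curl_mul`, `adjoint_curlOp`).  WHAT IS DONE HERE (kernel facts about
that definition, no new notion):
* §1 the EXPLICIT local formula — for a plaquette field `F` on `T^{(j)}` and a bond `(x, κ)`,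
  `(∂^*F)(x,κ) = c·(Σ_{ν>κ}[F(x;κ,ν) − F(x−e_ν;κ,ν)] + Σ_{μ<κ}[F(x−e_μ;μ,κ) − F(x;μ,κ)])` (`plaqDiv_apply`): the bond `(x,κ)`
  occurs in the plaquettes `(x;κ,ν)`, `(x−e_ν;κ,ν)` (`ν > κ`) and `(x−e_μ;μ,κ)`, `(x;μ,κ)` (`μ < κ`) with the signs of
  `(∂A)(x;μ,ν) = c·(A(x,μ) + A(x+e_μ,ν) − A(x+e_ν,μ) − A(x,ν))` (`LatticeFieldCalculus.curl_apply`);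
* §2 its agreement with the tree's covariant divergence on plaquette fields, [Balaban1985RegularSpaces] (1.2)
  `LatticeFieldCalculus.covDivPlaq R c U F`, at the trivial background `U = 1` and any representation datum with `R 1 = id`:
  `covDivPlaq R c 1 F = plaqDiv c F` (`covDivPlaq_one_eq_plaqDiv`) — so the `∂^*` of (5.3.1) is the existing notion, not a new one.
Unit `lit-balaban-p30` (literature-prover-lit-balaban-p30-g3-0), 2026-08-21.
-/

open scoped BigOperators


namespace Literature.MathematicalPhysics.QuantumFieldTheory.BalabanImbrieJaffe1984to88.BIJ85Eq531ProofPart2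

open Literature.MathematicalPhysics.QuantumFieldTheory.Balaban1983to89
open LatticeFieldCalculus BIJ85Eq531Proof

/-! ## 1.–2. The explicit local formula of `∂^*` and its agreement with the covariant divergence of
[Balaban1985RegularSpaces] (1.2) (`LatticeFieldCalculus.covDivPlaq`) at the trivial background -/

section Explicit

variable {P : Params} {j : ℕ}

/-- `(x − e_μ) + e_μ = x`. [folklore] -/
private theorem shift_unshift' (x : Site P j) (μ : Fin P.d) : (x.unshift μ).shift μ = x := by
  funext ν
  by_cases h : ν = μ
  · subst h; simp [Site.shift, Site.unshift]
  · simp [Site.shift, Site.unshift, Function.update_of_ne h]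

/-- `(x + e_μ) − e_μ = x`. [folklore] -/
private theorem unshift_shift' (x : Site P j) (μ : Fin P.d) : (x.shift μ).unshift μ = x := by
  funext ν
  by_cases h : ν = μ
  · subst h; simp [Site.shift, Site.unshift]
  · simp [Site.shift, Site.unshift, Function.update_of_ne h]

/-- `x′ + e_μ = x ↔ x′ = x − e_μ`. [folklore] -/
private theorem shift_eq_iff (x' x : Site P j) (μ : Fin P.d) : x'.shift μ = x ↔ x' = x.unshift μ := by
  constructor
  · rintro rfl; rw [unshift_shift']
  · rintro rfl; rw [shift_unshift']

/-- A sum over the positively oriented plaquettes `p = p_{μν}(x)`, `μ < ν`, as a sum over sites and ordered pairs of directions.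
[folklore] -/
private theorem sum_plaq {α : Type*} [AddCommMonoid α] (G : Plaq P j → α) :
    ∑ p : Plaq P j, G p = ∑ x : Site P j, ∑ μ : Fin P.d, ∑ ν : Fin P.d, if h : μ < ν then G ⟨x, μ, ν, h⟩ else 0 := by
  classical
  have h1 : (∑ x : Site P j, ∑ μ : Fin P.d, ∑ ν : Fin P.d, if h : μ < ν then G ⟨x, μ, ν, h⟩ else 0)
      = ∑ t : Site P j × Fin P.d × Fin P.d, if h : t.2.1 < t.2.2 then G ⟨t.1, t.2.1, t.2.2, h⟩ else 0 := by
    simp only [Fintype.sum_prod_type]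
  have h2 : (∑ t : Site P j × Fin P.d × Fin P.d, if h : t.2.1 < t.2.2 then G ⟨t.1, t.2.1, t.2.2, h⟩ else 0)
      = ∑ t ∈ (Finset.univ.filter fun t : Site P j × Fin P.d × Fin P.d => t.2.1 < t.2.2),
          if h : t.2.1 < t.2.2 then G ⟨t.1, t.2.1, t.2.2, h⟩ else 0 := by
    rw [Finset.sum_filter_of_ne]
    intro t _ ht
    by_contra hlt
    exact ht (dif_neg hlt)
  have h3 : (∑ t ∈ (Finset.univ.filter fun t : Site P j × Fin P.d × Fin P.d => t.2.1 < t.2.2),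
          if h : t.2.1 < t.2.2 then G ⟨t.1, t.2.1, t.2.2, h⟩ else 0)
      = ∑ t : {t : Site P j × Fin P.d × Fin P.d // t.2.1 < t.2.2}, G ⟨t.1.1, t.1.2.1, t.1.2.2, t.2⟩ := by
    rw [Finset.sum_subtype (p := fun t : Site P j × Fin P.d × Fin P.d => t.2.1 < t.2.2) _ (fun t => by simp)]
    exact Finset.sum_congr rfl fun t _ => dif_pos t.2
  have h4 : (∑ t : {t : Site P j × Fin P.d × Fin P.d // t.2.1 < t.2.2}, G ⟨t.1.1, t.1.2.1, t.1.2.2, t.2⟩)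
      = ∑ p : Plaq P j, G p :=
    Fintype.sum_equiv ⟨fun t => ⟨t.1.1, t.1.2.1, t.1.2.2, t.2⟩, fun p => ⟨(p.src, p.μ, p.ν), p.hμν⟩, fun _ => rfl, fun _ => rfl⟩
      _ _ fun _ => rfl
  rw [h1, h2, h3, h4]

open Classical in
/-- kernel: the fibre sums of the four incidence relations «bond `b` is the i-th boundary bond of the plaquette `p`» — first bond
`⟨x, x + e_μ⟩` of `p_{μν}(x)`. [folklore] -/
private theorem sum_ite_bond1 (F : Plaq P j → ℝ) (x : Site P j) (κ : Fin P.d) :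
    ∑ p : Plaq P j, (if (⟨p.src, p.μ⟩ : PBond P j) = ⟨x, κ⟩ then F p else 0)
      = ∑ ν : Fin P.d, if h : κ < ν then F ⟨x, κ, ν, h⟩ else 0 := by
  classical
  rw [sum_plaq]
  simp only [PBond.mk.injEq]
  rw [Finset.sum_eq_single_of_mem x (Finset.mem_univ x)]
  · rw [Finset.sum_eq_single_of_mem κ (Finset.mem_univ κ)]
    · refine Finset.sum_congr rfl fun ν _ => ?_
      by_cases h : κ < ν
      · rw [dif_pos h, dif_pos h, if_pos ⟨rfl, rfl⟩]
      · rw [dif_neg h, dif_neg h]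
    · intro μ _ hμ
      refine Finset.sum_eq_zero fun ν _ => ?_
      by_cases h : μ < ν
      · rw [dif_pos h, if_neg (fun hh => hμ hh.2)]
      · rw [dif_neg h]
  · intro x' _ hx'
    refine Finset.sum_eq_zero fun μ _ => Finset.sum_eq_zero fun ν _ => ?_
    by_cases h : μ < ν
    · rw [dif_pos h, if_neg (fun hh => hx' hh.1)]
    · rw [dif_neg h]

open Classical in
/-- kernel: fibre sum — fourth bond `⟨x, x + e_ν⟩` of `p_{μν}(x)`. [folklore] -/
private theorem sum_ite_bond4 (F : Plaq P j → ℝ) (x : Site P j) (κ : Fin P.d) :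
    ∑ p : Plaq P j, (if (⟨p.src, p.ν⟩ : PBond P j) = ⟨x, κ⟩ then F p else 0)
      = ∑ μ : Fin P.d, if h : μ < κ then F ⟨x, μ, κ, h⟩ else 0 := by
  classical
  rw [sum_plaq]
  simp only [PBond.mk.injEq]
  rw [Finset.sum_eq_single_of_mem x (Finset.mem_univ x)]
  · refine Finset.sum_congr rfl fun μ _ => ?_
    rw [Finset.sum_eq_single_of_mem κ (Finset.mem_univ κ)]
    · by_cases h : μ < κ
      · rw [dif_pos h, dif_pos h, if_pos ⟨rfl, rfl⟩]
      · rw [dif_neg h, dif_neg h]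
    · intro ν _ hν
      by_cases h : μ < ν
      · rw [dif_pos h, if_neg (fun hh => hν hh.2)]
      · rw [dif_neg h]
  · intro x' _ hx'
    refine Finset.sum_eq_zero fun μ _ => Finset.sum_eq_zero fun ν _ => ?_
    by_cases h : μ < ν
    · rw [dif_pos h, if_neg (fun hh => hx' hh.1)]
    · rw [dif_neg h]

open Classical in
/-- kernel: fibre sum — second bond `⟨x + e_μ, x + e_μ + e_ν⟩` of `p_{μν}(x)`. [folklore] -/
private theorem sum_ite_bond2 (F : Plaq P j → ℝ) (x : Site P j) (κ : Fin P.d) :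
    ∑ p : Plaq P j, (if (⟨p.src.shift p.μ, p.ν⟩ : PBond P j) = ⟨x, κ⟩ then F p else 0)
      = ∑ μ : Fin P.d, if h : μ < κ then F ⟨x.unshift μ, μ, κ, h⟩ else 0 := by
  classical
  rw [sum_plaq]
  simp only [PBond.mk.injEq, shift_eq_iff]
  rw [Finset.sum_comm]
  refine Finset.sum_congr rfl fun μ _ => ?_
  rw [Finset.sum_eq_single_of_mem (x.unshift μ) (Finset.mem_univ _)]
  · rw [Finset.sum_eq_single_of_mem κ (Finset.mem_univ κ)]
    · by_cases h : μ < κ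
      · rw [dif_pos h, dif_pos h, if_pos ⟨rfl, rfl⟩]
      · rw [dif_neg h, dif_neg h]
    · intro ν _ hν
      by_cases h : μ < ν
      · rw [dif_pos h, if_neg (fun hh => hν hh.2)]
      · rw [dif_neg h]
  · intro x' _ hx'
    refine Finset.sum_eq_zero fun ν _ => ?_
    by_cases h : μ < ν
    · rw [dif_pos h, if_neg (fun hh => hx' hh.1)]
    · rw [dif_neg h]

open Classical in
/-- kernel: fibre sum — third bond `⟨x + e_ν, x + e_ν + e_μ⟩` of `p_{μν}(x)`. [folklore] -/
private theorem sum_ite_bond3 (F : Plaq P j → ℝ) (x : Site P j) (κ : Fin P.d) :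
    ∑ p : Plaq P j, (if (⟨p.src.shift p.ν, p.μ⟩ : PBond P j) = ⟨x, κ⟩ then F p else 0)
      = ∑ ν : Fin P.d, if h : κ < ν then F ⟨x.unshift ν, κ, ν, h⟩ else 0 := by
  classical
  rw [sum_plaq]
  simp only [PBond.mk.injEq, shift_eq_iff]
  rw [Finset.sum_comm]
  -- now Σ_μ Σ_x' Σ_ν ; want to fix μ = κ and x' = x.unshift ν (depends on ν): reorder to Σ_μ Σ_ν Σ_x'
  rw [Finset.sum_eq_single_of_mem κ (Finset.mem_univ κ)]
  · rw [Finset.sum_comm]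
    refine Finset.sum_congr rfl fun ν _ => ?_
    rw [Finset.sum_eq_single_of_mem (x.unshift ν) (Finset.mem_univ _)]
    · by_cases h : κ < ν
      · rw [dif_pos h, dif_pos h, if_pos ⟨rfl, rfl⟩]
      · rw [dif_neg h, dif_neg h]
    · intro x' _ hx'
      by_cases h : κ < ν
      · rw [dif_pos h, if_neg (fun hh => hx' hh.1)]
      · rw [dif_neg h]
  · intro μ _ hμ
    refine Finset.sum_eq_zero fun x' _ => Finset.sum_eq_zero fun ν _ => ?_
    by_cases h : μ < ν
    · rw [dif_pos h, if_neg (fun hh => hμ hh.2)]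
    · rw [dif_neg h]

open Classical in
/-- **The explicit local formula of `∂^*`**: for the bond `b = ⟨x, x + e_κ⟩`,
`(∂^*F)(b) = c·(Σ_{ν>κ}(F(p_{κν}(x)) − F(p_{κν}(x − e_ν))) + Σ_{μ<κ}(F(p_{μκ}(x − e_μ)) − F(p_{μκ}(x))))` — the `2(d−1)` plaquettes
containing `b`, with the signs of the boundary orientation; this is [Balaban1985RegularSpaces] (1.2) at the trivial background
(`covDivPlaq_one_eq_plaqDiv`). [cite: BalabanImbrieJaffe1985, (4.2.2) p.310] -/
theorem plaqDiv_apply (c : ℝ) (F : Plaq P j → ℝ) (x : Site P j) (κ : Fin P.d) :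
    plaqDiv c F ⟨x, κ⟩ = c * ((∑ ν : Fin P.d, if h : κ < ν then F ⟨x, κ, ν, h⟩ - F ⟨x.unshift ν, κ, ν, h⟩ else 0)
      + ∑ μ : Fin P.d, if h : μ < κ then F ⟨x.unshift μ, μ, κ, h⟩ - F ⟨x, μ, κ, h⟩ else 0) := by
  have hexp : ∀ p : Plaq P j, curl c (Pi.single (⟨x, κ⟩ : PBond P j) (1 : ℝ)) p * F p
      = c * ((if (⟨p.src, p.μ⟩ : PBond P j) = ⟨x, κ⟩ then F p else 0)
        + (if (⟨p.src.shift p.μ, p.ν⟩ : PBond P j) = ⟨x, κ⟩ then F p else 0)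
        - (if (⟨p.src.shift p.ν, p.μ⟩ : PBond P j) = ⟨x, κ⟩ then F p else 0)
        - (if (⟨p.src, p.ν⟩ : PBond P j) = ⟨x, κ⟩ then F p else 0)) := by
    intro p
    simp only [curl, smul_eq_mul, Pi.single_apply]
    split_ifs <;> ring
  unfold plaqDiv
  rw [Finset.sum_congr rfl fun p _ => hexp p, ← Finset.mul_sum, Finset.sum_sub_distrib, Finset.sum_sub_distrib,
    Finset.sum_add_distrib, sum_ite_bond1, sum_ite_bond2, sum_ite_bond3, sum_ite_bond4]
  congr 1
  have e1 : ∀ ν : Fin P.d, (if h : κ < ν then F ⟨x, κ, ν, h⟩ - F ⟨x.unshift ν, κ, ν, h⟩ else (0 : ℝ))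
      = (if h : κ < ν then F ⟨x, κ, ν, h⟩ else 0) - (if h : κ < ν then F ⟨x.unshift ν, κ, ν, h⟩ else 0) := by
    intro ν; split_ifs <;> ring
  have e2 : ∀ μ : Fin P.d, (if h : μ < κ then F ⟨x.unshift μ, μ, κ, h⟩ - F ⟨x, μ, κ, h⟩ else (0 : ℝ))
      = (if h : μ < κ then F ⟨x.unshift μ, μ, κ, h⟩ else 0) - (if h : μ < κ then F ⟨x, μ, κ, h⟩ else 0) := by
    intro μ; split_ifs <;> ring
  simp only [e1, e2, Finset.sum_sub_distrib]
  ring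

/-- **`∂^*` = the covariant divergence of [Balaban1985RegularSpaces] (1.2) at `U = 1`**: for every gauge group and every linear action
`R` with `R(1) = 1`, `LatticeFieldCalculus.covDivPlaq R c 1 F = ∂^*F` on real plaquette fields (there:
`(D*_UF)_μ(x) = Σ_{ν<μ}(D*_{U,ν}F_{νμ})(x) − Σ_{ν>μ}(D*_{U,ν}F_{μν})(x)`, `(D*_{1,ν}f)(x) = c·(f(x − e_ν) − f(x))`).
[cite: Balaban1985RegularSpaces, (1.2) p.76] -/
theorem covDivPlaq_one_eq_plaqDiv {G : Type*} [GaugeGroup G] (R : G → ℝ →ₗ[ℝ] ℝ) (hR : R 1 = LinearMap.id) (c : ℝ)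
    (F : Plaq P j → ℝ) : covDivPlaq R c (1 : GaugeField P j G) F = plaqDiv c F := by
  funext b
  obtain ⟨x, κ⟩ := b
  rw [plaqDiv_apply]
  simp only [covDivPlaq, covDAdj_one R hR, pdiffAdj, smul_eq_mul]
  have e1 : ∀ ν : Fin P.d, (if h : ν < κ then c * (F ⟨x.unshift ν, ν, κ, h⟩ - F ⟨x, ν, κ, h⟩) else (0 : ℝ))
      = c * (if h : ν < κ then F ⟨x.unshift ν, ν, κ, h⟩ - F ⟨x, ν, κ, h⟩ else 0) := by
    intro ν; split_ifs <;> ring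
  have e2 : ∀ ν : Fin P.d, (if h : κ < ν then c * (F ⟨x.unshift ν, κ, ν, h⟩ - F ⟨x, κ, ν, h⟩) else (0 : ℝ))
      = c * (if h : κ < ν then F ⟨x.unshift ν, κ, ν, h⟩ - F ⟨x, κ, ν, h⟩ else 0) := by
    intro ν; split_ifs <;> ring
  simp only [e1, e2, ← Finset.mul_sum]
  have e3 : ∀ ν : Fin P.d, (if h : κ < ν then F ⟨x.unshift ν, κ, ν, h⟩ - F ⟨x, κ, ν, h⟩ else (0 : ℝ))
      = -(if h : κ < ν then F ⟨x, κ, ν, h⟩ - F ⟨x.unshift ν, κ, ν, h⟩ else 0) := by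
    intro ν; split_ifs <;> ring
  simp only [e3, Finset.sum_neg_distrib]
  ring

end Explicit

end Literature.MathematicalPhysics.QuantumFieldTheory.BalabanImbrieJaffe1984to88.BIJ85Eq531ProofPart2
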